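import Literature.MathematicalPhysics.QuantumFieldTheory.Balaban1983to89.TreeLengthTorus
import Literature.MathematicalPhysics.QuantumFieldTheory.Balaban1983to89.B13Geometry236
import Literature.MathematicalPhysics.QuantumFieldTheory.Balaban1983to89.B12Decay510Torus

/-!
# The TWO-POINT tree-length resummation on the torus: Σ_{X̄ ∋ □₁, □₂} e^{−κ d_j(X̄)} ≤ e^{−(κ/2)·D} · K₀ from (1.26)

[Balaban1988RG2Cluster] (1.26) p. 8 bounds the ONE-POINT sum `Σ_{X ∈ 𝐃_j, X ∋ □} exp(−κ d_j(X)) ≤ K₀` (the tree's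
`TreeLengthTorus.sum_exp_torusTreeLen_le`, every torus, no hypotheses on the geometry).  Every use of the localized
representation [Balaban1987RG1] (1.7) p. 261 at TWO marked points — the existence of the infinite-volume limit (1.21) p. 264 of
the vacuum-polarization kernel «by the localized representation (1.7)», its decay (5.10) p. 293 `|Π_{μν}(x − y)| ≤ O(1) e^{−δ₁|x−y|}`
«with a positive constant δ₁ determined by δ₀, κ, and M» — needs the TWO-POINT form: the sum over the localization domains
containing two given cubes decays exponentially in their separation.  This module proves it on the torus catalogue of
`TreeLengthTorus` (cubes `TPt d N = (ℤ/N)^d`, covering projection `proj N : ℤ^d → (ℤ/N)^d`, linear size `torusTreeLen` = the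
infimum of the lengths of the admissible graphs in the universal cover):

* §1 `le_torusTreeLen_of_lift_separation` — if EVERY pair of lifts `x₁ ∈ proj⁻¹ □₁`, `x₂ ∈ proj⁻¹ □₂` is `≥ D + 1` apart in some
  coordinate, then every torus-face-connected family `X̄ ∋ □₁, □₂` has `d_j(X̄) ≥ D`: an admissible graph is connected, meets a lift cube
  of each, and two points of those cubes are `≥ D` apart in the sup metric, so pv22's CAPTURE LEMMA `TreeLength.le_lenIn_closedBall`
  gives length `≥ D`.  (The lift-pair hypothesis is the torus sup-distance of the two cubes being `≥ D + 1`, spelled without a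
  torus-metric definition.)
* §2 `exp_torusTreeLen_le_two_point` — hence `e^{−κ d_j(X̄)} ≤ e^{−(κ/2) D} · e^{−(κ/2) d_j(X̄)}` for `κ ≥ 0`; and the TWO-POINT SUM
  `sum_exp_torusTreeLen_two_point_le`: for `κ/2 ≥ κ₀(4·2^d, 2d)`,
  `Σ_{X̄ ∋ □₁, □₂, face-connected} e^{−κ d_j(X̄)} ≤ e^{−(κ/2)·D} · K₀(4·2^d, 2d)` — (1.26) at rate `κ/2` after splitting the exponential.
* §3 THE SAME IN SITE CURRENCY (the (5.10) reading: sites of the torus `T₁` with `N·M` sites per direction, cubes `tcubeOf N M`, periodic ℓ¹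
  distance `pl1` of `B12Decay510Torus`): `sum_exp_torusTreeLen_two_sites_le` —
  `Σ_{X̄ ∋ □(p), □(q), face-connected} e^{−κ d_j(X̄)} ≤ e^{3κ/2} · e^{−(κ/(2Md))·|p − q|} · K₀(4·2^d, 2d)`, from b03g2's site-level diameter bound
  `B12Decay510Torus.pl1_sub_le_torusTreeLen_sites` (`|p − q| ≤ Md(d_j(X̄) + 3)`) — the shape in which the window sites `siteOfInt F K j z ∕ 0` of
  `Node00.polWindow` are read (`|·| = pl1`, eventually `= |z|₁`).

Design: theorems only (no definition; in §1–§2 the separation is a hypothesis on lift pairs, in §3 it is the periodic ℓ¹ distance of two sites);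
constants are pv03's `B12TreeDecay.kappa₀ ∕ K₀` exactly as in the one-point lemma.  What is NOT here: the eventual isometry `pl1 (siteOfInt F K j z −
siteOfInt F K j 0) = |z|₁` of def-B's window for large volumes (the consumers', Summit side), and any estimate of Bałaban's functionals — this is
lattice-animal geometry only.

References: [Balaban1988RG2Cluster] = T. Bałaban, Renormalization group approach to lattice gauge field theories. II, Commun. Math.
Phys. 116 (1988) 1–22, (1.26) p. 8; [Balaban1987RG1] = part I, Commun. Math. Phys. 109 (1987) 249–301, p. 257 (localization domains,
d_j), (1.7) p. 261, (1.21) p. 264, (5.10) p. 293 (pages 264, 292–293 read this session from `paper:balaban1987-cmp109-rg-i-small-field`).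
-/

namespace Literature.MathematicalPhysics.QuantumFieldTheory.Balaban1983to89.TreeLengthTorus

noncomputable section

open Literature.MathematicalPhysics.QuantumFieldTheory.Balaban1983to89
open Literature.MathematicalPhysics.QuantumFieldTheory.Balaban1983to89.B13ScaleTransfer
open Literature.MathematicalPhysics.QuantumFieldTheory.Balaban1983to89.TreeLength
open Literature.MathematicalPhysics.QuantumFieldTheory.Balaban1983to89.B12TreeDecay
open Literature.MathematicalPhysics.QuantumFieldTheory.Balaban1983to89.B13Geometry236 (lenIn_le_len)
open scoped BigOperators

variable {d N : ℕ}

/-! ## §1 Two marked cubes far apart on the torus force a long admissible graph -/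

/-- Points of two unit cubes are, in each coordinate, at least as far apart as the cube indices minus one:
`|x₁ μ − x₂ μ| − 1 ≤ |t₁ μ − t₂ μ|` for `t₁ ∈ cube x₁`, `t₂ ∈ cube x₂`. [folklore] -/
private theorem abs_sub_index_sub_one_le_of_mem_cube {x₁ x₂ : Pt d} {t₁ t₂ : RPt d} (h₁ : t₁ ∈ cube x₁) (h₂ : t₂ ∈ cube x₂) (μ : Fin d) :
    |(x₁ μ : ℝ) - (x₂ μ : ℝ)| - 1 ≤ |t₁ μ - t₂ μ| := by
  obtain ⟨a₁, b₁⟩ := (mem_cube.1 h₁) μ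
  obtain ⟨a₂, b₂⟩ := (mem_cube.1 h₂) μ
  have h3 := le_abs_self (t₁ μ - t₂ μ)
  have h4 := neg_abs_le (t₁ μ - t₂ μ)
  rw [sub_le_iff_le_add]
  refine abs_le.2 ⟨?_, ?_⟩ <;> linarith

/-- **TWO MARKED CUBES FAR APART ON THE TORUS FORCE A LONG GRAPH**: if every lift `x₁` of the cube `□₁` and every lift `x₂` of `□₂`
(under the covering projection `proj N : ℤ^d → (ℤ/N)^d`) are at least `D + 1` apart in some coordinate, then every torus-face-connected
family `X̄` containing `□₁` and `□₂` has linear size `d_j(X̄) ≥ D`.  Proof: an admissible graph in the universal cover is connected, lies in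
`π⁻¹(X̄)` and meets a lift cube of each marked cube ([Balaban1987RG1] p. 257 «tree graphs contained in X and intersecting all the cubes in
X»); two such meeting points are `≥ D` apart in the sup metric, and the capture lemma `TreeLength.le_lenIn_closedBall` bounds the length from
below by `D`. [cite: Balaban1987RG1, p.257 (linear size d_j)] -/
theorem le_torusTreeLen_of_lift_separation [NeZero N] {X : Finset (TPt d N)} (hX : TFaceConnected X) {c₁ c₂ : TPt d N}
    (hc₁ : c₁ ∈ X) (hc₂ : c₂ ∈ X) {D : ℝ}
    (hsep : ∀ x₁ x₂ : Pt d, proj N x₁ = c₁ → proj N x₂ = c₂ → ∃ μ : Fin d, D + 1 ≤ |(x₁ μ : ℝ) - (x₂ μ : ℝ)|) :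
    D ≤ torusTreeLen X := by
  by_cases hD : D ≤ 0
  · exact hD.trans (torusTreeLen_nonneg X)
  have hDpos : 0 < D := lt_of_not_ge hD
  have hne : ∃ T, TAdmissible X T := (exists_tAdmissible ⟨c₁, hc₁⟩ hX).imp fun T h => h.1
  refine le_torusTreeLen hne fun T hT => ?_
  obtain ⟨x₁, hx₁, t₁, ht₁T, ht₁⟩ := hT.meets c₁ hc₁
  obtain ⟨x₂, hx₂, t₂, ht₂T, ht₂⟩ := hT.meets c₂ hc₂
  obtain ⟨μ, hμ⟩ := hsep x₁ x₂ hx₁ hx₂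
  have hcoord : D ≤ |t₁ μ - t₂ μ| := by
    have := abs_sub_index_sub_one_le_of_mem_cube ht₁ ht₂ μ
    linarith
  have hdist : D ≤ dist t₁ t₂ := by
    refine hcoord.trans ?_
    rw [← Real.dist_eq]
    exact dist_le_pi_dist t₁ t₂ μ
  calc D ≤ lenIn (Metric.closedBall t₁ D) T := le_lenIn_closedBall hT.connected.isPreconnected ht₁T ht₂T hDpos hdist
    _ ≤ len T := lenIn_le_len _ T

/-! ## §2 The two-point resummation from (1.26) -/

/-- Splitting the exponential: under the separation hypothesis of §1 and `0 ≤ κ`,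
`e^{−κ d_j(X̄)} ≤ e^{−(κ/2)·D} · e^{−(κ/2) d_j(X̄)}`. [cite: Balaban1988RG2Cluster, (1.26) p.8] -/
theorem exp_torusTreeLen_le_two_point [NeZero N] {X : Finset (TPt d N)} (hX : TFaceConnected X) {c₁ c₂ : TPt d N}
    (hc₁ : c₁ ∈ X) (hc₂ : c₂ ∈ X) {D κ : ℝ} (hκ : 0 ≤ κ)
    (hsep : ∀ x₁ x₂ : Pt d, proj N x₁ = c₁ → proj N x₂ = c₂ → ∃ μ : Fin d, D + 1 ≤ |(x₁ μ : ℝ) - (x₂ μ : ℝ)|) :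
    Real.exp (-κ * torusTreeLen X) ≤ Real.exp (-(κ / 2) * D) * Real.exp (-(κ / 2) * torusTreeLen X) := by
  rw [← Real.exp_add]
  apply Real.exp_le_exp.2
  have h := le_torusTreeLen_of_lift_separation hX hc₁ hc₂ hsep
  have : κ / 2 * D ≤ κ / 2 * torusTreeLen X := mul_le_mul_of_nonneg_left h (by linarith)
  linarith

/-- **THE TWO-POINT SUM — [Balaban1988RG2Cluster] (1.26) p. 8 AT TWO MARKED CUBES**: for every torus, every pair of cubes `□₁, □₂` whose lifts
are `≥ D + 1` apart in some coordinate (pairwise), and every `κ` with `κ/2 ≥ κ₀(4·2^d, 2d)`,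
`Σ_{X̄ ∋ □₁, □₂, torus-face-connected} e^{−κ d_j(X̄)} ≤ e^{−(κ/2)·D} · K₀(4·2^d, 2d)` — the one-point bound (1.26)
(`sum_exp_torusTreeLen_le`, at rate `κ/2`) after the splitting of `exp_torusTreeLen_le_two_point`.  This is the resummation behind
[Balaban1987RG1]'s «This limit exists by the localized representation (1.7)» (p. 264) and the kernel decay (5.10) p. 293.
[cite: Balaban1988RG2Cluster, (1.26) p.8] -/
theorem sum_exp_torusTreeLen_two_point_le (d N : ℕ) [NeZero N] (c₁ c₂ : TPt d N) {κ D : ℝ}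
    (hκ : kappa₀ (4 * 2 ^ d) (2 * d) ≤ κ / 2)
    (hsep : ∀ x₁ x₂ : Pt d, proj N x₁ = c₁ → proj N x₂ = c₂ → ∃ μ : Fin d, D + 1 ≤ |(x₁ μ : ℝ) - (x₂ μ : ℝ)|)
    [DecidablePred fun X : Finset (TPt d N) => c₁ ∈ X ∧ c₂ ∈ X ∧ TFaceConnected X]
    [DecidablePred fun X : Finset (TPt d N) => c₁ ∈ X ∧ TFaceConnected X] :
    ∑ X ∈ (Finset.univ : Finset (Finset (TPt d N))).filter (fun X => c₁ ∈ X ∧ c₂ ∈ X ∧ TFaceConnected X),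
        Real.exp (-κ * torusTreeLen X) ≤
      Real.exp (-(κ / 2) * D) * K₀ (4 * 2 ^ d) (2 * d) := by
  have hκ0 : 0 ≤ κ := by
    have := kappa₀_nonneg (show (0 : ℝ) ≤ 4 * 2 ^ d by positivity) (2 * d)
    linarith
  have hone := sum_exp_torusTreeLen_le d N c₁ hκ
  calc ∑ X ∈ (Finset.univ : Finset (Finset (TPt d N))).filter (fun X => c₁ ∈ X ∧ c₂ ∈ X ∧ TFaceConnected X),
          Real.exp (-κ * torusTreeLen X)
      ≤ ∑ X ∈ (Finset.univ : Finset (Finset (TPt d N))).filter (fun X => c₁ ∈ X ∧ c₂ ∈ X ∧ TFaceConnected X),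
          Real.exp (-(κ / 2) * D) * Real.exp (-(κ / 2) * torusTreeLen X) := by
        refine Finset.sum_le_sum fun X hXm => ?_
        obtain ⟨-, h₁, h₂, hc⟩ := Finset.mem_filter.1 hXm
        exact exp_torusTreeLen_le_two_point hc h₁ h₂ hκ0 hsep
    _ = Real.exp (-(κ / 2) * D) *
          ∑ X ∈ (Finset.univ : Finset (Finset (TPt d N))).filter (fun X => c₁ ∈ X ∧ c₂ ∈ X ∧ TFaceConnected X),
            Real.exp (-(κ / 2) * torusTreeLen X) := by rw [Finset.mul_sum]
    _ ≤ Real.exp (-(κ / 2) * D) *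
          ∑ X ∈ (Finset.univ : Finset (Finset (TPt d N))).filter (fun X => c₁ ∈ X ∧ TFaceConnected X),
            Real.exp (-(κ / 2) * torusTreeLen X) := by
        refine mul_le_mul_of_nonneg_left ?_ (Real.exp_nonneg _)
        refine Finset.sum_le_sum_of_subset_of_nonneg (fun X hXm => ?_) (fun _ _ _ => Real.exp_nonneg _)
        obtain ⟨hu, h₁, -, hc⟩ := Finset.mem_filter.1 hXm
        exact Finset.mem_filter.2 ⟨hu, h₁, hc⟩
    _ ≤ Real.exp (-(κ / 2) * D) * K₀ (4 * 2 ^ d) (2 * d) := mul_le_mul_of_nonneg_left hone (Real.exp_nonneg _)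

/-- The two-point sum is symmetric in the rôle of the marked cubes: the same bound with the one-point resummation taken at `□₂`
(useful when the consumer's filter lists `□₂` first). [cite: Balaban1988RG2Cluster, (1.26) p.8] -/
theorem sum_exp_torusTreeLen_two_point_le' (d N : ℕ) [NeZero N] (c₁ c₂ : TPt d N) {κ D : ℝ}
    (hκ : kappa₀ (4 * 2 ^ d) (2 * d) ≤ κ / 2)
    (hsep : ∀ x₁ x₂ : Pt d, proj N x₁ = c₁ → proj N x₂ = c₂ → ∃ μ : Fin d, D + 1 ≤ |(x₁ μ : ℝ) - (x₂ μ : ℝ)|)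
    [DecidablePred fun X : Finset (TPt d N) => c₂ ∈ X ∧ c₁ ∈ X ∧ TFaceConnected X]
    [DecidablePred fun X : Finset (TPt d N) => c₂ ∈ X ∧ TFaceConnected X] :
    ∑ X ∈ (Finset.univ : Finset (Finset (TPt d N))).filter (fun X => c₂ ∈ X ∧ c₁ ∈ X ∧ TFaceConnected X),
        Real.exp (-κ * torusTreeLen X) ≤
      Real.exp (-(κ / 2) * D) * K₀ (4 * 2 ^ d) (2 * d) := by
  have hsep' : ∀ x₂ x₁ : Pt d, proj N x₂ = c₂ → proj N x₁ = c₁ → ∃ μ : Fin d, D + 1 ≤ |(x₂ μ : ℝ) - (x₁ μ : ℝ)| := by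
    intro x₂ x₁ h₂ h₁
    obtain ⟨μ, hμ⟩ := hsep x₁ x₂ h₁ h₂
    exact ⟨μ, by rwa [abs_sub_comm]⟩
  exact sum_exp_torusTreeLen_two_point_le d N c₂ c₁ hκ hsep'

/-! ## §3 The two-point sum in site currency (periodic ℓ¹ distance, cubes of side `M`) -/

section Sites

open Literature.MathematicalPhysics.QuantumFieldTheory.Balaban1983to89.B12Decay510Torus (pl1 tcubeOf pl1_sub_le_torusTreeLen_sites)

/-- **[Balaban1988RG2Cluster] (1.26) AT TWO MARKED SITES, (5.10) CURRENCY**: on the torus `T₁` with `N·M` sites per direction and cubes of side `M`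
(`B12Decay510Torus.tcubeOf`), for `0 < d`, `κ/2 ≥ κ₀(4·2^d, 2d)` and any two sites `p, q`,
`Σ_{X̄ ∋ □(p), □(q), torus-face-connected} e^{−κ d_j(X̄)} ≤ e^{3κ/2} · e^{−(κ/(2Md))·|p − q|} · K₀(4·2^d, 2d)`, `|·|` the periodic ℓ¹ length `pl1` —
from the site-level diameter bound `pl1_sub_le_torusTreeLen_sites` (`|p − q| ≤ Md (d_j(X̄) + 3)`) and the one-point sum (1.26) at rate `κ/2`.  This is the
resummation by which [Balaban1987RG1] (5.10) p. 293 reads «δ₁ determined by δ₀, κ, and M (e.g., δ₁ = ½ min{δ₀, κM⁻¹})» at hard-localized terms.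
[cite: Balaban1988RG2Cluster, (1.26) p.8] -/
theorem sum_exp_torusTreeLen_two_sites_le (d N M : ℕ) [NeZero N] [NeZero M] (hd : 0 < d) (p q : TPt d (N * M)) {κ : ℝ}
    (hκ : kappa₀ (4 * 2 ^ d) (2 * d) ≤ κ / 2)
    [DecidablePred fun X : Finset (TPt d N) => tcubeOf N M p ∈ X ∧ tcubeOf N M q ∈ X ∧ TFaceConnected X]
    [DecidablePred fun X : Finset (TPt d N) => tcubeOf N M p ∈ X ∧ TFaceConnected X] :
    ∑ X ∈ (Finset.univ : Finset (Finset (TPt d N))).filter (fun X => tcubeOf N M p ∈ X ∧ tcubeOf N M q ∈ X ∧ TFaceConnected X),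
        Real.exp (-κ * torusTreeLen X) ≤
      Real.exp (3 * (κ / 2)) * Real.exp (-(κ / 2 / ((M : ℝ) * d)) * pl1 (p - q)) * K₀ (4 * 2 ^ d) (2 * d) := by
  have hκ0 : 0 ≤ κ := by
    have := kappa₀_nonneg (show (0 : ℝ) ≤ 4 * 2 ^ d by positivity) (2 * d)
    linarith
  have hMd : (0 : ℝ) < (M : ℝ) * d := by
    have hM : (0 : ℝ) < M := by exact_mod_cast Nat.pos_of_neZero M
    have hd' : (0 : ℝ) < d := by exact_mod_cast hd
    exact mul_pos hM hd'
  have hone := sum_exp_torusTreeLen_le d N (tcubeOf N M p) hκ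
  -- pointwise splitting with the site-level diameter bound
  have hpt : ∀ X ∈ (Finset.univ : Finset (Finset (TPt d N))).filter (fun X => tcubeOf N M p ∈ X ∧ tcubeOf N M q ∈ X ∧ TFaceConnected X),
      Real.exp (-κ * torusTreeLen X) ≤
        Real.exp (3 * (κ / 2)) * Real.exp (-(κ / 2 / ((M : ℝ) * d)) * pl1 (p - q)) * Real.exp (-(κ / 2) * torusTreeLen X) := by
    intro X hXm
    obtain ⟨-, hp, hq, hc⟩ := Finset.mem_filter.1 hXm
    have hdiam := pl1_sub_le_torusTreeLen_sites ⟨_, hp⟩ hc hp hq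
    -- `pl1 (p - q) / (M d) - 3 ≤ d_j(X̄)`
    have hlow : pl1 (p - q) / ((M : ℝ) * d) - 3 ≤ torusTreeLen X := by
      rw [sub_le_iff_le_add, div_le_iff₀ hMd]
      nlinarith
    rw [← Real.exp_add, ← Real.exp_add]
    apply Real.exp_le_exp.2
    have h2 : 0 ≤ κ / 2 := by linarith
    have := mul_le_mul_of_nonneg_left hlow h2
    have e : -(κ / 2 / ((M : ℝ) * d)) * pl1 (p - q) = -(κ / 2 * (pl1 (p - q) / ((M : ℝ) * d))) := by
      rw [neg_mul]
      congr 1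
      field_simp
    rw [e]
    linarith
  calc ∑ X ∈ (Finset.univ : Finset (Finset (TPt d N))).filter (fun X => tcubeOf N M p ∈ X ∧ tcubeOf N M q ∈ X ∧ TFaceConnected X),
          Real.exp (-κ * torusTreeLen X)
      ≤ ∑ X ∈ (Finset.univ : Finset (Finset (TPt d N))).filter (fun X => tcubeOf N M p ∈ X ∧ tcubeOf N M q ∈ X ∧ TFaceConnected X),
          Real.exp (3 * (κ / 2)) * Real.exp (-(κ / 2 / ((M : ℝ) * d)) * pl1 (p - q)) * Real.exp (-(κ / 2) * torusTreeLen X) :=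
        Finset.sum_le_sum hpt
    _ = Real.exp (3 * (κ / 2)) * Real.exp (-(κ / 2 / ((M : ℝ) * d)) * pl1 (p - q)) *
          ∑ X ∈ (Finset.univ : Finset (Finset (TPt d N))).filter (fun X => tcubeOf N M p ∈ X ∧ tcubeOf N M q ∈ X ∧ TFaceConnected X),
            Real.exp (-(κ / 2) * torusTreeLen X) := by rw [Finset.mul_sum]
    _ ≤ Real.exp (3 * (κ / 2)) * Real.exp (-(κ / 2 / ((M : ℝ) * d)) * pl1 (p - q)) *
          ∑ X ∈ (Finset.univ : Finset (Finset (TPt d N))).filter (fun X => tcubeOf N M p ∈ X ∧ TFaceConnected X),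
            Real.exp (-(κ / 2) * torusTreeLen X) := by
        refine mul_le_mul_of_nonneg_left ?_ (by positivity)
        refine Finset.sum_le_sum_of_subset_of_nonneg (fun X hXm => ?_) (fun _ _ _ => Real.exp_nonneg _)
        obtain ⟨hu, h₁, -, hc⟩ := Finset.mem_filter.1 hXm
        exact Finset.mem_filter.2 ⟨hu, h₁, hc⟩
    _ ≤ Real.exp (3 * (κ / 2)) * Real.exp (-(κ / 2 / ((M : ℝ) * d)) * pl1 (p - q)) * K₀ (4 * 2 ^ d) (2 * d) :=
        mul_le_mul_of_nonneg_left hone (by positivity)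

end Sites

end

end Literature.MathematicalPhysics.QuantumFieldTheory.Balaban1983to89.TreeLengthTorus
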